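/-
Copyright (c) 2026 the pub-hodgecm-mathlib formalisation cell (harness21).  Prover seat hodgecm-mathlib-LH3-p03 (g6): LH3 «Transf» road, letter L3′ surjective half,
brick (Σ4c-sec) (carve F0P3a-p04 (g25) 2026-09-02T12:57:32Z∕13:01:37Z; consumer LH10-p02 (g7) ★ (Σ4c-asm) `exists_classDescent_of_section_of_descent`; census LH10-p02 (g7)).
-/
import Literature.NumberTheory.Rogawski1990.ArchBouazizClassMapSectionPlace   -- (this seat) part 1: `exists_section_compactPlace`, `exists_section_splitPlace`; brings ★ p851469 `ArchBouazizClassMap`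
import HarnessLib

/-!
# (Σ4c-sec) A SMOOTH LOCAL SECTION OF THE STABLE-CLASS MAP OF A CHART, ON ITS IMAGE (Bouaziz 1994 §2.3, §5.1; Rogawski 1990 §3.6, §8.2)

Topic `NumberTheory/Rogawski1990`; namespace `Literature.NumberTheory.Rogawski1990`.  THEOREMS ONLY (no `def`, no instance, no notation, no axiom, no named fact, no `sorry`);
GROUP-FREE (coordinates `c : W → Fin 3 → ℝ`, any `[Fintype W] [DecidableEq W]`).  Cell `pub/hodgecm-mathlib`, crux H413 (`stmt-HodgeConjecture-24833`), F0∕P3c line LH3 (closer stub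
`stub_N9`, leaf `F0_P3c_StubN9Direct`), letter L3′ `stub_N9bouazizSurjective`, v10 organ `BouazizSurjOfForwardStatement` (RULING #22), SURJ road (binder LH10-p01 (g5)), organ (Σ-REG)
(F0P3a-p04 (g25)), interface (Σ4c) `exists_classDescent` — ★ p851524 `exists_classDescent_of_section_of_descent` (LH10-p02 (g7)) takes two carve inputs: (Σ4c-desc) ★ p851530∕p851534
`div_eq_div_of_bzClassMap_eq` and **(Σ4c-sec) — this file** (assembly) over its part 1 `ArchBouazizClassMapSectionPlace.lean` (the per-place sections).

THE RESULT **`exists_contDiffOn_section_bzClassMap (S) (hc₀ : c₀ ∈ RegS S) : ∃ U, IsOpen U ∧ bzClassMap S c₀ ∈ U ∧ ∃ σ, ContDiffOn ℝ ∞ σ U ∧ σ (bzClassMap S c₀) = c₀ ∧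
(∀ c, bzClassMap S c ∈ U → bzClassMap S (σ (bzClassMap S c)) = bzClassMap S c) ∧ (∀ c, bzClassMap S c ∈ U → σ (bzClassMap S c) ∈ RegS S)`** (F0P3a-p04's 4-clause text) and its
3-clause form **`exists_contDiffOn_section_bzClassMap₃`** = ★ p851524's `hsec` binder token for token.  The class map ★ `bzClassMap S c w` is `(e₀ + e₂, e₀e₂, e₁)` at a compact place
(`e_i = e^{i c_{w,i}}`) and `((eˣ + e⁻ˣ)e^{iθ}, e^{2iθ}, e^{ic₁})` at a split place (`x = c_{w,0}`, `θ = c_{w,2}`); it is NOT injective (Weyl moves, `2π`), so the section is asked ON THE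
IMAGE only: `bzClassMap S (σ y) = y` for `y = bzClassMap S c ∈ U`.
CONSTRUCTION (explicit, no inverse-function theorem; LH10-p02 (g7)'s census, F0P3a-p04's formulas), place by place (`U = ⋂_w eval_w⁻¹ V_w`, `σ y w = τ_w (y w)`):
per place the sections of part 1 (`exists_section_bzClassMap_place` dispatches compact ∕ split by `w ∈ S` through ★ `bzClassMap_of_mem ∕ _of_not_mem`), `U` open as a finite
intersection of preimages under the evaluations, `σ` smooth by `contDiffOn_pi` and `contDiff_apply`, the identities coordinate-wise (`bzClassMap_congr`: the class at `w` reads only the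
`w`-coordinate), regularity `RegS` place-wise from the per-place non-degeneracies.
HONEST LABEL: count-neutral; one carve input of (Σ4c); HC_CM is proved only modulo the 7 printed citations (2 remaining: hLiu418 = stmt-HodgeConjecture-24832, h413 =
stmt-HodgeConjecture-24833) until rung 0 closes.

## References
* [Bouaziz1994IntegralesOrbitales] A. Bouaziz, *Intégrales orbitales sur les groupes de Lie réductifs*, Ann. Sci. ÉNS (4) 27 (1994) 573–609: §2.3 p. 578, §5.1 p. 588 (functions of the stable class).
* [Rogawski1990] J. D. Rogawski, *Automorphic Representations of Unitary Groups in Three Variables*, Ann. of Math. Stud. 123 (1990), §3.6 p. 31 (stable classes in `U(2)`, `U(1,1)` by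
  eigenvalue data), §8.2 p. 122 (the Cartan charts).
-/

set_option autoImplicit false

noncomputable section

open Complex Set Function Real Topology
open scoped ContDiff
open Literature.NumberTheory.Automorphic.ArchCartan

namespace Literature.NumberTheory.Rogawski1990

/-! ## §4 The section of the class map of a chart, place by place -/

section Assembly

variable {W : Type*} [Fintype W] [DecidableEq W]

omit [Fintype W] in
/-- Per place: a smooth local section of the `w`-component of `bzClassMap S` at a regular base point, with the section identity ON THE IMAGE and regularity of the values
(§2 at a compact place, §3 at a split place). [cite: Rogawski1990, §3.6 p. 31] [cite: Bouaziz1994IntegralesOrbitales, §5.1 p. 588] -/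
theorem exists_section_bzClassMap_place (S : Finset W) {c₀ : W → Fin 3 → ℝ} (hc₀ : c₀ ∈ RegS S) (w : W) :
    ∃ (V : Set (ℂ × ℂ × ℂ)) (τ : ℂ × ℂ × ℂ → (Fin 3 → ℝ)), IsOpen V ∧ bzClassMap S c₀ w ∈ V ∧ ContDiffOn ℝ ∞ τ V ∧ τ (bzClassMap S c₀ w) = c₀ w ∧
      ∀ c : W → Fin 3 → ℝ, bzClassMap S c w ∈ V →
        bzClassMap S (Function.update c w (τ (bzClassMap S c w))) w = bzClassMap S c w ∧
        (w ∈ S → τ (bzClassMap S c w) 0 ≠ 0) ∧ (w ∉ S → Circle.exp (τ (bzClassMap S c w) 0) ≠ Circle.exp (τ (bzClassMap S c w) 2)) := by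
  by_cases hw : w ∈ S
  · obtain ⟨V, hV, h0, τ, hτ, hτ0, hsec⟩ := exists_section_splitPlace (c₀ w) (hc₀.2 w hw)
    refine ⟨V, τ, hV, by rw [bzClassMap_of_mem hw]; exact h0, hτ, by rw [bzClassMap_of_mem hw]; exact hτ0, fun c hc => ?_⟩
    have hc' := hc
    rw [bzClassMap_of_mem hw] at hc'
    obtain ⟨hid, hne⟩ := hsec (c w) hc'
    simp only [bzClassMap_of_mem hw, Function.update_self]
    exact ⟨hid, fun _ => hne, fun h => absurd hw h⟩
  · obtain ⟨V, hV, h0, τ, hτ, hτ0, hsec⟩ := exists_section_compactPlace (c₀ w) (hc₀.1 w hw)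
    refine ⟨V, τ, hV, by rw [bzClassMap_of_not_mem hw]; exact h0, hτ, by rw [bzClassMap_of_not_mem hw]; exact hτ0, fun c hc => ?_⟩
    have hc' := hc
    rw [bzClassMap_of_not_mem hw] at hc'
    obtain ⟨hid, hne⟩ := hsec (c w) hc'
    simp only [bzClassMap_of_not_mem hw, Function.update_self]
    exact ⟨hid, fun h => absurd h hw, fun _ => hne⟩

/-- **(Σ4c-sec) A SMOOTH LOCAL SECTION OF THE CLASS MAP ON ITS IMAGE** (carve F0P3a-p04 (g25), 4-clause head): at a regular chart point `c₀ ∈ RegS S` there are an open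
neighbourhood `U` of `bzClassMap S c₀` in `W → ℂ × ℂ × ℂ` and a map `σ : (W → ℂ × ℂ × ℂ) → (W → Fin 3 → ℝ)`, `C^∞` on `U`, with `σ (bzClassMap S c₀) = c₀`, the SECTION IDENTITY
`bzClassMap S (σ y) = y` for every `y ∈ U` IN THE IMAGE of `bzClassMap S`, and `σ y ∈ RegS S` for such `y` — place by place (`U = ⋂_w eval_w⁻¹ V_w`, `σ y w = τ_w (y w)`).
[cite: Rogawski1990, §3.6 p. 31; §8.2 p. 122] [cite: Bouaziz1994IntegralesOrbitales, §2.3 p. 578; §5.1 p. 588] -/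
theorem exists_contDiffOn_section_bzClassMap (S : Finset W) {c₀ : W → Fin 3 → ℝ} (hc₀ : c₀ ∈ RegS S) :
    ∃ U : Set (W → ℂ × ℂ × ℂ), IsOpen U ∧ bzClassMap S c₀ ∈ U ∧
      ∃ σ : (W → ℂ × ℂ × ℂ) → (W → Fin 3 → ℝ), ContDiffOn ℝ ∞ σ U ∧ σ (bzClassMap S c₀) = c₀ ∧
        (∀ c : W → Fin 3 → ℝ, bzClassMap S c ∈ U → bzClassMap S (σ (bzClassMap S c)) = bzClassMap S c) ∧
        (∀ c : W → Fin 3 → ℝ, bzClassMap S c ∈ U → σ (bzClassMap S c) ∈ RegS S) := by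
  choose V τ hVo hV0 hτs hτ0 hsec using exists_section_bzClassMap_place S hc₀
  refine ⟨{Y | ∀ w, Y w ∈ V w}, ?_, fun w => hV0 w, fun Y w => τ w (Y w), ?_, ?_, ?_, ?_⟩
  · have hU : {Y : W → ℂ × ℂ × ℂ | ∀ w, Y w ∈ V w} = ⋂ w, (fun Y : W → ℂ × ℂ × ℂ => Y w) ⁻¹' V w := by ext Y; simp
    rw [hU]
    exact isOpen_iInter_of_finite fun w => (hVo w).preimage (continuous_apply w)
  · refine contDiffOn_pi.2 fun w => ?_
    exact (hτs w).comp (contDiff_apply ℝ (ℂ × ℂ × ℂ) w).contDiffOn fun Y hY => hY w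
  · funext w
    exact hτ0 w
  · intro c hc
    funext w
    have h1 := (hsec w c (hc w)).1
    rw [← h1]
    exact bzClassMap_congr S (by simp)
  · intro c hc
    exact ⟨fun w hw => (hsec w c (hc w)).2.2 hw, fun w hw => (hsec w c (hc w)).2.1 hw⟩

/-- **The 3-clause form** = the `hsec` binder of ★ p851524 `exists_classDescent_of_section_of_descent` (LH10-p02 (g7)) token for token. [cite: Bouaziz1994IntegralesOrbitales, §5.1 p. 588] -/
theorem exists_contDiffOn_section_bzClassMap₃ (S : Finset W) {c₀ : W → Fin 3 → ℝ} (hc₀ : c₀ ∈ RegS S) :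
    ∃ U : Set (W → ℂ × ℂ × ℂ), IsOpen U ∧ bzClassMap S c₀ ∈ U ∧
      ∃ σ : (W → ℂ × ℂ × ℂ) → (W → Fin 3 → ℝ), ContDiffOn ℝ ∞ σ U ∧ σ (bzClassMap S c₀) = c₀ ∧
        ∀ c : W → Fin 3 → ℝ, bzClassMap S c ∈ U → bzClassMap S (σ (bzClassMap S c)) = bzClassMap S c := by
  obtain ⟨U, hU, h0, σ, hσ, hσ0, hid, -⟩ := exists_contDiffOn_section_bzClassMap S hc₀
  exact ⟨U, hU, h0, σ, hσ, hσ0, hid⟩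

end Assembly

end Literature.NumberTheory.Rogawski1990

end
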